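import Mathlib
import Summits.Ventures.PercRepro2.Defs
import Summits.Ventures.PercRepro2.Independence
import Summits.Ventures.PercRepro2.Harris
import Summits.Ventures.PercRepro2.Graph
import Summits.Ventures.PercRepro2.OneEdge
import Summits.Ventures.PercRepro2.XWForm
import Summits.Ventures.PercRepro2.XWEdgeSY
import Summits.Ventures.PercRepro2.XWEdgeUO

/-!
# (XW) is concave in the weight of a `u–o` edge: the defect and the removal theorem
(PercRepro2, p2 g26; part 2 of XWEdgeUO.lean)

With the forced-open form of XWEdgeUO.lean (`xwBil_update_one_eq`, `xwBil_update_one_nonneg`)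
the one-edge Bernstein expansion `xxwBil_bernstein` at an edge `e = {u, o}`, `t = p e`, reads

  `XW(p) = (1 − t)·XW(p[e↦0]) + t·XW(p[e↦1]) + t(1 − t)·D_uo(p[e↦0])`      (`xwBil_eq_uo_edge`)

with the concavity defect **`D_uo = P(h ∩ aᶜ)·P(b ∩ λᶜ) − P(S ∩ a ∩ λᶜ)·P(S ∩ aᶜ ∩ λ)`** (`dUO`;
`a = {s ↔ u}`, `λ = {y ↔ o}`, `S = {s ↔ y}`, `h = {s ↔ o}`, `b = {y ↔ u}`, `Q = Sᶜ`), which is a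
SUM OF PRODUCTS OF PROBABILITIES,

  `D_uo = P(S ∩ aᶜ ∩ λ)·P(Q ∩ b ∩ λᶜ) + P(Q ∩ h ∩ aᶜ)·P(S ∩ a ∩ λᶜ) + P(Q ∩ h ∩ aᶜ)·P(Q ∩ b ∩ λᶜ)`

(`dUO_eq_sum`: on `S` the event `h ∩ aᶜ` is `λ ∩ aᶜ` and `b ∩ λᶜ` is `a ∩ λᶜ`), hence **`0 ≤ D_uo`**
(`dUO_nonneg`) — the conjecture (C-uo) of record P2-G25-XWSTRUCT.md §9 («XW is concave in `p_uo`»,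
census 0 / 2,015) is a THEOREM (`xwBil_ge_of_uo_edge`) — and

  **`xwBil_nonneg_of_uo_edge`: if (XW) holds with `e` closed, it holds at `p`** — the `u–o` edge
  can be deleted without loss, for every weight.  Identity checked numerically 150/150 before
  formalisation (own code).  Own work; standard axioms.
-/

namespace Summit.Ventures.PercRepro2

namespace XWEdgeUO

variable {V : Type*} {E : Type*} [Fintype E] [DecidableEq E] {R : Type*} [CommRing R]

variable (ends : E → Sym2 V) (s y o u : V)

variable {ends s y o u}

/-! ## The defect -/

variable (ends s y o u) in
/-- **The `u–o` concavity defect** `D_uo = P(h ∩ aᶜ)·P(b ∩ λᶜ) − P(S ∩ a ∩ λᶜ)·P(S ∩ aᶜ ∩ λ)`. -/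
noncomputable def dUO (p : E → R) : R :=
  prob p (connEvent ends s o ∩ (connEvent ends s u)ᶜ) *
      prob p (connEvent ends y u ∩ (connEvent ends y o)ᶜ) -
    prob p (connEvent ends s y ∩ connEvent ends s u ∩ (connEvent ends y o)ᶜ) *
      prob p (connEvent ends s y ∩ (connEvent ends s u)ᶜ ∩ connEvent ends y o)

omit [Fintype E] [DecidableEq E] in
/-- On `S`, `h ∩ aᶜ` is `λ ∩ aᶜ`. -/
lemma S_inter_h_na :
    connEvent ends s y ∩ (connEvent ends s o ∩ (connEvent ends s u)ᶜ) =
      connEvent ends s y ∩ (connEvent ends s u)ᶜ ∩ connEvent ends y o := by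
  ext ω
  simp only [Set.mem_inter_iff, Set.mem_compl_iff, mem_connEvent]
  constructor
  · rintro ⟨hsy, hso, hsu⟩
    exact ⟨⟨hsy, hsu⟩, conn_trans (conn_symm hsy) hso⟩
  · rintro ⟨⟨hsy, hsu⟩, hyo⟩
    exact ⟨hsy, conn_trans hsy hyo, hsu⟩

omit [Fintype E] [DecidableEq E] in
/-- On `S`, `b ∩ λᶜ` is `a ∩ λᶜ`. -/
lemma S_inter_b_nl :
    connEvent ends s y ∩ (connEvent ends y u ∩ (connEvent ends y o)ᶜ) =
      connEvent ends s y ∩ connEvent ends s u ∩ (connEvent ends y o)ᶜ := by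
  ext ω
  simp only [Set.mem_inter_iff, Set.mem_compl_iff, mem_connEvent]
  constructor
  · rintro ⟨hsy, hyu, hyo⟩
    exact ⟨⟨hsy, conn_trans hsy hyu⟩, hyo⟩
  · rintro ⟨⟨hsy, hsu⟩, hyo⟩
    exact ⟨hsy, conn_trans (conn_symm hsy) hsu, hyo⟩

variable (ends s y o u) in
/-- **The defect is a sum of products of probabilities**:
`D_uo = P(S ∩ aᶜ ∩ λ)·P(Q ∩ b ∩ λᶜ) + P(Q ∩ h ∩ aᶜ)·P(S ∩ a ∩ λᶜ) + P(Q ∩ h ∩ aᶜ)·P(Q ∩ b ∩ λᶜ)`. -/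
theorem dUO_eq_sum (p : E → R) :
    dUO ends s y o u p =
      prob p (connEvent ends s y ∩ (connEvent ends s u)ᶜ ∩ connEvent ends y o) *
          prob p ((connEvent ends s y)ᶜ ∩ (connEvent ends y u ∩ (connEvent ends y o)ᶜ)) +
        prob p ((connEvent ends s y)ᶜ ∩ (connEvent ends s o ∩ (connEvent ends s u)ᶜ)) *
          prob p (connEvent ends s y ∩ connEvent ends s u ∩ (connEvent ends y o)ᶜ) +
        prob p ((connEvent ends s y)ᶜ ∩ (connEvent ends s o ∩ (connEvent ends s u)ᶜ)) *
          prob p ((connEvent ends s y)ᶜ ∩ (connEvent ends y u ∩ (connEvent ends y o)ᶜ)) := by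
  unfold dUO
  have e1 : prob p (connEvent ends s o ∩ (connEvent ends s u)ᶜ) =
      prob p (connEvent ends s y ∩ (connEvent ends s u)ᶜ ∩ connEvent ends y o) +
        prob p ((connEvent ends s y)ᶜ ∩ (connEvent ends s o ∩ (connEvent ends s u)ᶜ)) := by
    rw [← prob_inter_add_prob_inter_compl p (connEvent ends s o ∩ (connEvent ends s u)ᶜ)
      (connEvent ends s y), Set.inter_comm _ (connEvent ends s y), S_inter_h_na,
      Set.inter_comm _ (connEvent ends s y)ᶜ]
  have e2 : prob p (connEvent ends y u ∩ (connEvent ends y o)ᶜ) =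
      prob p (connEvent ends s y ∩ connEvent ends s u ∩ (connEvent ends y o)ᶜ) +
        prob p ((connEvent ends s y)ᶜ ∩ (connEvent ends y u ∩ (connEvent ends y o)ᶜ)) := by
    rw [← prob_inter_add_prob_inter_compl p (connEvent ends y u ∩ (connEvent ends y o)ᶜ)
      (connEvent ends s y), Set.inter_comm _ (connEvent ends s y), S_inter_b_nl,
      Set.inter_comm _ (connEvent ends s y)ᶜ]
  rw [e1, e2]
  ring

variable (ends s y o u) in
/-- **(C-uo) is a theorem**: `0 ≤ D_uo`. -/
theorem dUO_nonneg [LinearOrder R] [IsStrictOrderedRing R] {p : E → R} (hp : IsProbVec p) :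
    0 ≤ dUO ends s y o u p := by
  rw [dUO_eq_sum]
  have h1 := prob_nonneg hp (connEvent ends s y ∩ (connEvent ends s u)ᶜ ∩ connEvent ends y o)
  have h2 := prob_nonneg hp ((connEvent ends s y)ᶜ ∩ (connEvent ends y u ∩ (connEvent ends y o)ᶜ))
  have h3 := prob_nonneg hp ((connEvent ends s y)ᶜ ∩ (connEvent ends s o ∩ (connEvent ends s u)ᶜ))
  have h4 := prob_nonneg hp (connEvent ends s y ∩ connEvent ends s u ∩ (connEvent ends y o)ᶜ)
  positivity

/-! ## The identity -/

omit [Fintype E] [DecidableEq E] in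
/-- `A = a ⊔ (aᶜ ∩ h)`. -/
lemma A_eq : A ends s o u = connEvent ends s u ∪ (connEvent ends s u)ᶜ ∩ connEvent ends s o := by
  ext ω
  simp only [A, Set.mem_union, Set.mem_inter_iff, Set.mem_compl_iff]
  tauto

omit [Fintype E] [DecidableEq E] in
/-- `L = λ ⊔ (λᶜ ∩ b)`. -/
lemma L_eq : L ends y o u = connEvent ends y o ∪ (connEvent ends y o)ᶜ ∩ connEvent ends y u := by
  ext ω
  simp only [L, Set.mem_union, Set.mem_inter_iff, Set.mem_compl_iff]
  tauto

omit [Fintype E] [DecidableEq E] in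
/-- `S₁ = S ⊔ (Q ∩ ((a ∩ λ) ∪ (h ∩ b)))`. -/
lemma S1_eq : S1 ends s y o u = connEvent ends s y ∪
    (connEvent ends s y)ᶜ ∩ (connEvent ends s u ∩ connEvent ends y o ∪
      connEvent ends s o ∩ connEvent ends y u) := by
  ext ω
  simp only [S1, Set.mem_union, Set.mem_inter_iff, Set.mem_compl_iff]
  tauto

omit [Fintype E] [DecidableEq E] in
/-- `A ∩ L = (S ∩ (a ∪ λ)) ⊔ (Q ∩ ((a ∩ λ) ∪ (h ∩ b)))`. -/
lemma A_inter_L_eq : A ends s o u ∩ L ends y o u =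
    connEvent ends s y ∩ (connEvent ends s u ∪ connEvent ends y o) ∪
      (connEvent ends s y)ᶜ ∩ (connEvent ends s u ∩ connEvent ends y o ∪
        connEvent ends s o ∩ connEvent ends y u) := by
  ext ω
  simp only [A, L, Set.mem_union, Set.mem_inter_iff, Set.mem_compl_iff, mem_connEvent]
  constructor
  · rintro ⟨hsu | hso, hyo | hyu⟩
    · by_cases hsy : Conn ends ω s y
      · exact Or.inl ⟨hsy, Or.inl hsu⟩
      · exact Or.inr ⟨hsy, Or.inl ⟨hsu, hyo⟩⟩
    · exact Or.inl ⟨conn_trans hsu (conn_symm hyu), Or.inl hsu⟩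
    · exact Or.inl ⟨conn_trans hso (conn_symm hyo), Or.inr hyo⟩
    · by_cases hsy : Conn ends ω s y
      · exact Or.inl ⟨hsy, Or.inr (conn_trans (conn_symm hsy) hso)⟩
      · exact Or.inr ⟨hsy, Or.inr ⟨hso, hyu⟩⟩
  · rintro (⟨hsy, hsu | hyo⟩ | ⟨_, ⟨hsu, hyo⟩ | ⟨hso, hyu⟩⟩)
    · exact ⟨Or.inl hsu, Or.inr (conn_trans (conn_symm hsy) hsu)⟩
    · exact ⟨Or.inr (conn_trans hsy hyo), Or.inl hyo⟩
    · exact ⟨Or.inl hsu, Or.inl hyo⟩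
    · exact ⟨Or.inr hso, Or.inr hyu⟩

omit [Fintype E] [DecidableEq E] in
/-- A set and a subset of its complement are disjoint. -/
lemma disjoint_compl_inter (X Y : Set (Config E)) : Disjoint X (Xᶜ ∩ Y) := by
  rw [Set.disjoint_left]
  rintro ω h ⟨h', _⟩
  exact h' h

variable (ends s y o u) in
/-- **The mixed coefficients**: `B(p₀, p₁) + B(p₁, p₀) = XW(p₀) + B(p₁, p₁) + D_uo(p₀)` for
`e = {u, o}`. -/
theorem xwBil_mixed_eq (p : E → R) {e : E} (he : ends e = s(u, o)) :
    xwBil ends s y o u (Function.update p e 0) (Function.update p e 1) +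
        xwBil ends s y o u (Function.update p e 1) (Function.update p e 0) =
      xwBil ends s y o u (Function.update p e 0) (Function.update p e 0) +
        xwBil ends s y o u (Function.update p e 1) (Function.update p e 1) +
        dUO ends s y o u (Function.update p e 0) := by
  rw [xwBil_update_one_eq ends s y o u p he]
  unfold xwBil dUO
  simp only [XWEdgeSY.prob_update_one_eq_update_zero_preimage p e, XWEdgeSY.preimage_inter,
    preimage_S (s := s) (y := y) he, preimage_a (s := s) he, preimage_l (y := y) he]
  rw [S1_inter_A_eq, S1_inter_L_eq, Set.inter_assoc, Set.inter_self]
  set q := Function.update p e 0 with hq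
  set S := connEvent ends s y with hS
  set a := connEvent ends s u with ha
  set l := connEvent ends y o with hl
  set h := connEvent ends s o with hh
  set b := connEvent ends y u with hb
  -- atoms
  set x := prob q (Sᶜ ∩ (a ∩ l ∪ h ∩ b)) with hx
  set hna := prob q (h ∩ aᶜ) with hhna
  set bnl := prob q (b ∩ lᶜ) with hbnl
  have eA : prob q (A ends s o u) = prob q a + hna := by
    rw [A_eq, prob_union_of_disjoint q (disjoint_compl_inter _ _), Set.inter_comm]
  have eL : prob q (L ends y o u) = prob q l + bnl := by
    rw [L_eq, prob_union_of_disjoint q (disjoint_compl_inter _ _), Set.inter_comm]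
  have eS1 : prob q (S1 ends s y o u) = prob q S + x := by
    rw [S1_eq, prob_union_of_disjoint q (disjoint_compl_inter _ _)]
  have eF : prob q (A ends s o u ∩ L ends y o u) =
      prob q (S ∩ a) + prob q (S ∩ l) - prob q (S ∩ a ∩ l) + x := by
    rw [A_inter_L_eq, prob_union_of_disjoint q]
    · have hu : prob q (S ∩ (a ∪ l)) = prob q (S ∩ a) + prob q (S ∩ l) - prob q (S ∩ a ∩ l) := by
        have := prob_union_add_prob_inter q (S ∩ a) (S ∩ l)
        have h1 : S ∩ a ∪ S ∩ l = S ∩ (a ∪ l) := (Set.inter_union_distrib_left S a l).symm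
        have h2 : S ∩ a ∩ (S ∩ l) = S ∩ a ∩ l := by
          ext ω; simp only [Set.mem_inter_iff]; tauto
        rw [h1, h2] at this
        linear_combination this
      rw [hu]
    · rw [Set.disjoint_left]
      rintro ω ⟨hS', _⟩ ⟨hQ, _⟩
      exact hQ hS'
  -- the cells `S ∩ a ∩ lᶜ`, `S ∩ aᶜ ∩ l`
  have e3 : prob q (S ∩ a ∩ lᶜ) = prob q (S ∩ a) - prob q (S ∩ a ∩ l) := by
    have := prob_inter_add_prob_inter_compl q (S ∩ a) l
    linear_combination this
  have e4 : prob q (S ∩ aᶜ ∩ l) = prob q (S ∩ l) - prob q (S ∩ a ∩ l) := by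
    have := prob_inter_add_prob_inter_compl q (S ∩ l) a
    rw [Set.inter_right_comm S l a, Set.inter_right_comm S l aᶜ] at this
    linear_combination this
  rw [eA, eL, eS1, eF, e3, e4]
  ring

variable (ends s y o u) in
/-- **The exact `u–o` edge identity**:
`XW(p) = (1 − t)·XW(p[e↦0]) + t·XW(p[e↦1]) + t(1 − t)·D_uo(p[e↦0])`, `t = p e`, `e = {u, o}`. -/
theorem xwBil_eq_uo_edge (p : E → R) {e : E} (he : ends e = s(u, o)) :
    xwBil ends s y o u p p =
      (1 - p e) * xwBil ends s y o u (Function.update p e 0) (Function.update p e 0) +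
        p e * xwBil ends s y o u (Function.update p e 1) (Function.update p e 1) +
        p e * (1 - p e) * dUO ends s y o u (Function.update p e 0) := by
  have hB := xxwBil_bernstein ends s y o u p p e
  have hmix := xwBil_mixed_eq ends s y o u p he
  rw [hB]
  linear_combination (p e * (1 - p e)) * hmix

variable (ends s y o u) in
/-- **(XW) is concave in the weight of a `u–o` edge**:
`XW(p) ≥ (1 − t)·XW(p[e↦0]) + t·XW(p[e↦1])`. -/
theorem xwBil_ge_of_uo_edge [LinearOrder R] [IsStrictOrderedRing R] {p : E → R}
    (hp : IsProbVec p) {e : E} (he : ends e = s(u, o)) :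
    (1 - p e) * xwBil ends s y o u (Function.update p e 0) (Function.update p e 0) +
        p e * xwBil ends s y o u (Function.update p e 1) (Function.update p e 1) ≤
      xwBil ends s y o u p p := by
  rw [xwBil_eq_uo_edge ends s y o u p he]
  have h1 : 0 ≤ 1 - p e := by linarith [hp.le_one e]
  have h2 : 0 ≤ p e := hp.nonneg e
  have h3 := dUO_nonneg ends s y o u (hp.update e (le_refl 0) zero_le_one)
  nlinarith [mul_nonneg (mul_nonneg h2 h1) h3]

variable (ends s y o u) in
/-- **THE `u–o` EDGE IS REMOVABLE**: if (XW) holds with `e = {u, o}` closed, it holds at `p`. -/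
theorem xwBil_nonneg_of_uo_edge [LinearOrder R] [IsStrictOrderedRing R] {p : E → R}
    (hp : IsProbVec p) {e : E} (he : ends e = s(u, o))
    (h0 : 0 ≤ xwBil ends s y o u (Function.update p e 0) (Function.update p e 0)) :
    0 ≤ xwBil ends s y o u p p := by
  refine le_trans ?_ (xwBil_ge_of_uo_edge ends s y o u hp he)
  have h1 : 0 ≤ 1 - p e := by linarith [hp.le_one e]
  have h2 : 0 ≤ p e := hp.nonneg e
  have h3 := xwBil_update_one_nonneg ends s y o u hp he
  positivity

end XWEdgeUO

end Summit.Ventures.PercRepro2
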